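import Mathlib
import Summits.NavierStokesRegularity.NavierStokesRegularity.Theses.StretchingWellBinding
import Summits.NavierStokesRegularity.NavierStokesRegularity.Theorems.StretchingWellBindingDssProfileBindingEnstrophy
import Summits.NavierStokesRegularity.NavierStokesRegularity.Theorems.StretchingWellBindingDssProfileBindingTestFields
import Literature.Analysis.FluidPDE.FlatSwirlGauge
import Literature.Analysis.FluidPDE.CurlFreeLiouville
import HarnessLib

/-!
# Route StretchingWellBinding — support item `DssProfileBinding` PROVED
  (stmt-NavierStokesRegularity-1578; file 4/4)

**Theorem (`stretchingWellBinding_dssProfileBinding_proof`, card F3 of the route, ansatz-free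
necessary conditions on discretely self-similar blow-up).** Let `(u, p)` be a classical solution of
unforced Navier–Stokes (`ν = 1`) on `ℝ³ × (−∞, 0)` which is `λ`-DSS (`λ > 1`,
`λ u(λ²t, λx) = u(t, x)`), obeys the scale-invariant bounds `(‖x‖ + √(−t))^{k+1} ‖Dᵏu(t,x)‖ ≤ C_k`
of all orders, and is not identically zero at some negative time. Then at some `t < 0` the
stretching well BINDS — some smooth compactly supported vector field `ψ` has
`∫ α₊(t)|ψ|² − ∫ |∇ψ|²_F > 0`, `α = ⟪ξ, ∇u ξ⟫`, `ξ = ω/|ω|` — and the stretching is SUPER-HARDY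
about EVERY centre: for all `x₀` there is `x` with `‖x − x₀‖² α₊(t,x) > ¼`.

Proof (the card's, made literal). (1) No binding at a time `t` gives, by truncating `ω(t)` with
the standard cut-offs (`DssBinding.tendsto_rayleigh_cutoff`) and `⟪ω, ∇u ω⟫ ≤ α₊|ω|²`, the bound
`∫⟪ω, ∇u ω⟫ ≤ ∫|∇ω|²_F`, hence `Ω'(t) ≤ 0` by the enstrophy identity
`Ω' = 2(∫⟪ω, ∇u ω⟫ − ∫|∇ω|²_F)` (`DssBinding.enstrophy_hasDerivAt`); so if the well never binds,
the enstrophy `Ω(t) = ∫|ω(t)|²` is non-increasing on `(−∞, 0)`. (2) Discrete self-similarity gives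
`Ω(t) = λ Ω(λ²t)` (change of variables), and `Ω(t₀) > 0` at the non-trivial time (a curl-free,
divergence-free, decaying slice vanishes: `eq_of_curl_eq_zero_of_isDivFree_of_bounded`), so
`Ω(λ²t₀) = Ω(t₀)/λ < Ω(t₀)` although `λ²t₀ < t₀` — contradiction. (3) At a binding time, if some
centre `x₀` had `‖x − x₀‖² α₊ ≤ ¼` everywhere, the sharp Hardy inequality
(`DssBinding.integral_weight_mul_norm_sq_le_of_hardySubcritical`, constant `4 · ¼ = 1`) would give
`∫ α₊|ψ|² ≤ ∫|∇ψ|²_F` for every test field — contradiction.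

HONEST FRAMING: a necessary condition on HYPOTHETICAL discretely self-similar blow-up profiles in
Chae–Wolf's Type-I class; no such object is asserted to exist, and nothing here bears on the
regularity question itself. Lands `--workitem stmt-NavierStokesRegularity-1578` (typer seat g19 of
cell pub-ns-dss, idle-row item; the idea is credited to this item by the cell's T38-SCOPE files).
-/

noncomputable section

set_option linter.dupNamespace false

namespace Summit.NavierStokesRegularity.NavierStokesRegularity.Theorems

open MeasureTheory Set Filter Topology Module Metric InnerProductSpace Function
open scoped RealInnerProductSpace Laplacian ContDiff
open Literature.Analysis Literature.Analysis.FluidPDE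
open Summit.NavierStokesRegularity.NavierStokesRegularity.Theorems.SimilarityEnstrophy
open Summit.NavierStokesRegularity.NavierStokesRegularity.Theorems.PlanarEnergyAPriori

namespace DssBinding

/-! ### Discrete self-similarity rescales the enstrophy: `Ω(t) = λ Ω(λ²t)` -/

/-- **`Ω(t) = λ Ω(λ² t)` for a `λ`-DSS field** (`ω(t,x) = λ² ω(λ²t, λx)` and the change of
variables `x ↦ λx` on `ℝ³`). [folklore] -/
theorem integral_norm_curl_sq_eq_of_dss {c : ℝ}
    {u : ℝ → EuclideanSpace ℝ (Fin 3) → EuclideanSpace ℝ (Fin 3)}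
    (hdss : IsDiscretelySelfSimilar c u) (hc : 0 < c) (t : ℝ) :
    ∫ x, ‖curl (u t) x‖ ^ 2 = c * ∫ x, ‖curl (u (c ^ 2 * t)) x‖ ^ 2 := by
  have hu : u t = fun x => c • u (c ^ 2 * t) (c • x) := by
    funext x
    have h := congrFun (congrFun hdss t) x
    rw [nsRescale_apply] at h
    exact h.symm
  have hcurl : ∀ x, curl (u t) x = (c * c) • curl (u (c ^ 2 * t)) (c • x) := by
    intro x; rw [hu]; exact curl_smul_comp_smul _ c c x
  simp_rw [hcurl, norm_smul, mul_pow]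
  rw [integral_const_mul]
  have hscale : ∫ x : EuclideanSpace ℝ (Fin 3), ‖curl (u (c ^ 2 * t)) (c • x)‖ ^ 2 =
      |(c ^ 3)⁻¹| * ∫ x, ‖curl (u (c ^ 2 * t)) x‖ ^ 2 := by
    have h := Measure.integral_comp_smul (volume : Measure (EuclideanSpace ℝ (Fin 3)))
      (fun y => ‖curl (u (c ^ 2 * t)) y‖ ^ 2) c
    rw [finrank_euclideanSpace_fin, smul_eq_mul] at h
    exact h
  rw [hscale, Real.norm_eq_abs, abs_of_pos (mul_pos hc hc), abs_of_pos (by positivity)]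
  field_simp

/-! ### A slice with zero enstrophy vanishes -/

/-- **Zero enstrophy forces a decaying divergence-free slice to vanish**: if `w ∈ C^∞` is
divergence free with `‖w(x)‖ ≤ K₀ (1 + ‖x‖)^{−1}` and `∫ ‖curl w‖² = 0` (the integrand being
integrable), then `w = 0` (continuity makes `curl w ≡ 0`; a bounded curl- and divergence-free field
is constant, `eq_of_curl_eq_zero_of_isDivFree_of_bounded`; the decay kills the constant). [folklore] -/
theorem slice_eq_zero_of_integral_norm_curl_sq_eq_zero
    {w : EuclideanSpace ℝ (Fin 3) → EuclideanSpace ℝ (Fin 3)} (hw : ContDiff ℝ ∞ w)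
    (hdiv : VectorCalculus.IsDivFree w) {K₀ : ℝ}
    (h0 : ∀ x, ‖w x‖ ≤ K₀ * (1 + ‖x‖) ^ (-(1 : ℝ)))
    (hint : Integrable fun x => ‖curl w x‖ ^ 2) (hZ : ∫ x, ‖curl w x‖ ^ 2 = 0) : w = 0 := by
  have hω : ContDiff ℝ ∞ (curl w) := contDiff_curl_smooth hw
  have hae : (fun x => ‖curl w x‖ ^ 2) =ᵐ[volume] 0 :=
    (integral_eq_zero_iff_of_nonneg (fun x => sq_nonneg _) hint).1 hZ
  have hzero : (fun x => ‖curl w x‖ ^ 2) = 0 :=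
    (Continuous.ae_eq_iff_eq (μ := volume) (hω.continuous.norm.pow 2) continuous_const).1 hae
  have hcurl : ∀ x, curl w x = 0 := fun x => by
    have h := congrFun hzero x
    simp only [Pi.zero_apply, ne_eq, OfNat.ofNat_ne_zero, not_false_eq_true, pow_eq_zero_iff,
      norm_eq_zero] at h
    exact h
  have hK₀ : 0 ≤ K₀ := SlabLaw.nonneg_of_norm_le_rpow h0
  have hbdd : ∀ x, ‖w x‖ ≤ K₀ := fun x =>
    (h0 x).trans (mul_le_of_le_one_right hK₀ (SlabLaw.rpow_neg_le_one x (by norm_num)))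
  have hconst := eq_of_curl_eq_zero_of_isDivFree_of_bounded (hw.of_le (by norm_cast)) hcurl hdiv hbdd
  funext x
  by_contra hx
  have hpos : 0 < ‖w x‖ := norm_pos_iff.2 hx
  obtain ⟨n, hn⟩ := exists_nat_gt (K₀ / ‖w x‖)
  obtain ⟨y, hny⟩ := exists_norm_eq (EuclideanSpace ℝ (Fin 3)) (show (0 : ℝ) ≤ (n : ℝ) + 1 by positivity)
  have h1 : ‖w x‖ = ‖w y‖ := by rw [hconst x y]
  have h2 : ‖w y‖ ≤ K₀ * ((n : ℝ) + 2)⁻¹ := by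
    have := h0 y
    rw [hny, Real.rpow_neg_one, show (1 + ((n : ℝ) + 1)) = (n : ℝ) + 2 by ring] at this
    exact this
  have h3 : K₀ < ‖w x‖ * ((n : ℝ) + 2) := by
    rw [div_lt_iff₀ hpos] at hn
    nlinarith
  have h4 : K₀ * ((n : ℝ) + 2)⁻¹ < ‖w x‖ := by
    rw [← div_eq_mul_inv, div_lt_iff₀ (by positivity)]
    exact h3
  linarith

/-! ### No binding at a time forces `∫⟪ω, ∇u ω⟫ ≤ ∫|∇ω|²_F` there -/

/-- **A non-binding slice has stretching dominated by dissipation.** For a smooth decaying slice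
`w` (`‖Dw‖ ≲ (1+‖x‖)^{−2}`, `‖D²w‖ ≲ (1+‖x‖)^{−3}`): if every smooth compactly supported test
field `ψ` has `∫ α₊|ψ|² − ∫|∇ψ|²_F ≤ 0` (`α = ⟪ξ, Dw ξ⟫`, `ξ = ω/|ω|`, `ω = curl w`), then
`∫⟪ω, Dw ω⟫ ≤ ∫|∇ω|²_F` (truncate `ω` by the standard cut-offs, pass to the limit, and use
`⟪ω, Dw ω⟫ ≤ α₊|ω|²`). [folklore] -/
theorem integral_stretching_le_of_noBinding
    {w : EuclideanSpace ℝ (Fin 3) → EuclideanSpace ℝ (Fin 3)} (hw : ContDiff ℝ ∞ w) {K₁ K₂ : ℝ}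
    (h1 : ∀ x, ‖fderiv ℝ w x‖ ≤ K₁ * (1 + ‖x‖) ^ (-(2 : ℝ)))
    (h2 : ∀ x, ‖iteratedFDeriv ℝ 2 w x‖ ≤ K₂ * (1 + ‖x‖) ^ (-(3 : ℝ)))
    (hnb : ∀ ψ : EuclideanSpace ℝ (Fin 3) → EuclideanSpace ℝ (Fin 3), ContDiff ℝ (⊤ : ℕ∞) ψ →
      HasCompactSupport ψ →
      (∫ x, max 0 (inner ℝ (vorticityDirection (curl w) x)
          ((fderiv ℝ w x) (vorticityDirection (curl w) x))) * ‖ψ x‖ ^ 2)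
        - (∫ x, frobeniusNormSq (fderiv ℝ ψ x)) ≤ 0) :
    ∫ x, ⟪curl w x, fderiv ℝ w x (curl w x)⟫ ≤ ∫ x, frobeniusNormSq (fderiv ℝ (curl w) x) := by
  have hω : ContDiff ℝ ∞ (curl w) := contDiff_curl_smooth hw
  set a : EuclideanSpace ℝ (Fin 3) → ℝ := fun x =>
    max 0 ⟪vorticityDirection (curl w) x, fderiv ℝ w x (vorticityDirection (curl w) x)⟫ with hadef
  have ha : Measurable a := measurable_posPart_stretchingRate (hw.of_le (by norm_cast)) hω.continuous
  have hK₁ : 0 ≤ K₁ := SlabLaw.nonneg_of_norm_le_rpow h1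
  have haA : ∀ x, |a x| ≤ K₁ := by
    intro x
    have hb := abs_inner_vorticityDirection_clm_apply_le (curl w) (fderiv ℝ w x) x
    have hD : ‖fderiv ℝ w x‖ ≤ K₁ :=
      (h1 x).trans (mul_le_of_le_one_right hK₁ (SlabLaw.rpow_neg_le_one x (by norm_num)))
    rw [hadef, abs_of_nonneg (le_max_left _ _), max_le_iff]
    exact ⟨hK₁, ((le_abs_self _).trans hb).trans hD⟩
  have iZ := integrable_norm_curl_sq hw h1
  have iF := integrable_frobeniusNormSq_fderiv_curl hw h2
  have iS := integrable_inner_stretching_curl hw h1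
  have hlim := tendsto_rayleigh_cutoff hω iZ iF ha haA
  have hle : ∀ n : ℕ, (∫ x, a x * ‖cutoff ((n : ℝ) + 1) x • curl w x‖ ^ 2)
      - ∫ x, frobeniusNormSq (fderiv ℝ (fun y => cutoff ((n : ℝ) + 1) y • curl w y) x) ≤ 0 :=
    fun n => hnb _ ((contDiff_cutoff _).smul hω)
      ((hasCompactSupport_cutoff (by positivity)).smul_right)
  have hL : (∫ x, a x * ‖curl w x‖ ^ 2) - ∫ x, frobeniusNormSq (fderiv ℝ (curl w) x) ≤ 0 :=
    le_of_tendsto' hlim hle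
  have iA : Integrable fun x => a x * ‖curl w x‖ ^ 2 :=
    iZ.bdd_mul ha.aestronglyMeasurable (Eventually.of_forall fun x => by
      rw [Real.norm_eq_abs]; exact haA x)
  have hmono : ∫ x, ⟪curl w x, fderiv ℝ w x (curl w x)⟫ ≤ ∫ x, a x * ‖curl w x‖ ^ 2 :=
    integral_mono iS iA fun x => inner_clm_apply_self_le_posPart_mul (curl w) (fderiv ℝ w x) x
  linarith

end DssBinding

open DssBinding

/-- **`DssProfileBinding` (card F3 of route StretchingWellBinding; stmt-NavierStokesRegularity-1578).**
A classical `λ`-DSS solution of unforced Navier–Stokes (`ν = 1`) on `ℝ³ × (−∞, 0)` with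
scale-invariant bounds of all orders, non-zero at some negative time, BINDS at some `t < 0` (some
smooth compactly supported `ψ` has `∫ α₊(t)|ψ|² − ∫|∇ψ|²_F > 0`) and is then SUPER-HARDY about every
centre (`∀ x₀ ∃ x, ¼ < ‖x − x₀‖² α₊(t,x)`). Proof: if the well never binds, the enstrophy is
non-increasing on `(−∞, 0)` (`integral_stretching_le_of_noBinding` + `enstrophy_hasDerivAt`), which
contradicts `Ω(t₀) = λ Ω(λ²t₀) > 0` (`integral_norm_curl_sq_eq_of_dss`,
`slice_eq_zero_of_integral_norm_curl_sq_eq_zero`); at a binding time a Hardy-subcritical centre is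
impossible by `integral_weight_mul_norm_sq_le_of_hardySubcritical`. [this file] -/
theorem stretchingWellBinding_dssProfileBinding_proof : Theses.StretchingWellBinding.DssProfileBinding := by
  intro c hc u p hsol hdss hD hne
  have hc0 : 0 < c := one_pos.trans hc
  -- Step 1: the well binds at some negative time
  have hbind : ∃ t < 0, ∃ ψ : EuclideanSpace ℝ (Fin 3) → EuclideanSpace ℝ (Fin 3),
      ContDiff ℝ (⊤ : ℕ∞) ψ ∧ HasCompactSupport ψ ∧
      0 < (∫ x, max 0 (inner ℝ (vorticityDirection (curl (u t)) x)
          ((fderiv ℝ (u t) x) (vorticityDirection (curl (u t)) x))) * ‖ψ x‖ ^ 2)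
        - (∫ x, frobeniusNormSq (fderiv ℝ ψ x)) := by
    by_contra hnb
    push Not at hnb
    -- the enstrophy and its derivative
    set Z : ℝ → ℝ := fun σ => ∫ x, ‖curl (u σ) x‖ ^ 2 with hZdef
    have hderiv : ∀ t < 0, HasDerivAt Z
        (2 * ((∫ x, ⟪curl (u t) x, fderiv ℝ (u t) x (curl (u t) x)⟫)
          - 1 * ∫ x, frobeniusNormSq (fderiv ℝ (curl (u t)) x))) t :=
      fun t ht => enstrophy_hasDerivAt hsol hD ht
    have hnonpos : ∀ t < 0, 2 * ((∫ x, ⟪curl (u t) x, fderiv ℝ (u t) x (curl (u t) x)⟫)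
          - 1 * ∫ x, frobeniusNormSq (fderiv ℝ (curl (u t)) x)) ≤ 0 := by
      intro t ht
      obtain ⟨K₀, K₁, K₂, K₃, hK⟩ := exists_sliceBounds hD ht
      obtain ⟨-, -, h1, h2, -⟩ := hK t le_rfl
      have h := integral_stretching_le_of_noBinding (hsol.contDiff_velocity ht) h1 h2
        (fun ψ hψ hψc => hnb t ht ψ hψ hψc)
      linarith
    -- `Z` is non-increasing on `(−∞, 0)`
    have hanti : AntitoneOn Z (Iio 0) := by
      have hint : interior (Iio (0 : ℝ)) = Iio 0 := interior_Iio
      refine antitoneOn_of_deriv_nonpos (convex_Iio 0) ?_ ?_ ?_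
      · exact fun t ht => (hderiv t ht).continuousAt.continuousWithinAt
      · rw [hint]; exact fun t ht => (hderiv t ht).differentiableAt.differentiableWithinAt
      · rw [hint]; intro t ht; rw [(hderiv t ht).deriv]; exact hnonpos t ht
    -- the non-trivial time has positive enstrophy
    obtain ⟨t₀, ht₀, hne₀⟩ := hne
    obtain ⟨K₀, K₁, K₂, K₃, hK⟩ := exists_sliceBounds hD ht₀
    obtain ⟨h0, -, h1, -, -⟩ := hK t₀ le_rfl
    have iZ := integrable_norm_curl_sq (hsol.contDiff_velocity ht₀) h1
    have hZpos : 0 < Z t₀ := by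
      rcases (integral_nonneg (f := fun x => ‖curl (u t₀) x‖ ^ 2) fun x => sq_nonneg _).eq_or_lt
        with h | h
      · exact absurd (slice_eq_zero_of_integral_norm_curl_sq_eq_zero (hsol.contDiff_velocity ht₀)
          (hsol.divFree t₀ ht₀) h0 iZ h.symm) hne₀
      · exact h
    -- DSS: `Z(t₀) = c Z(c² t₀)`, but `Z(c² t₀) ≥ Z(t₀)` since `c² t₀ < t₀`
    have hdssZ : Z t₀ = c * Z (c ^ 2 * t₀) := integral_norm_curl_sq_eq_of_dss hdss hc0 t₀
    have hc2 : 1 < c ^ 2 := by nlinarith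
    have hlt : c ^ 2 * t₀ < t₀ := by nlinarith
    have hneg : c ^ 2 * t₀ < 0 := by nlinarith
    have hmono : Z t₀ ≤ Z (c ^ 2 * t₀) := hanti hneg ht₀ hlt.le
    nlinarith
  -- Step 2: at a binding time, no centre is Hardy-subcritical
  obtain ⟨t, ht, ψ, hψ, hψc, hpos⟩ := hbind
  refine ⟨t, ht, ⟨ψ, hψ, hψc, hpos⟩, fun x₀ => ?_⟩
  by_contra hsub
  push Not at hsub
  have hle := integral_weight_mul_norm_sq_le_of_hardySubcritical (hψ.of_le (by norm_cast)) hψc x₀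
    (fun x => le_max_left _ _) hsub
  linarith

end Summit.NavierStokesRegularity.NavierStokesRegularity.Theorems

end
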